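import Summits.Ventures.PercRepro.ExploreTree

/-!
# The depth-first exploration of a cluster as a decision tree (Gladkov, Algorithm 2)

`MultiGraph.dfs T U top L Q` is the decision tree that explores the cluster of a start vertex
in the first configuration in depth-first order, sends every queried edge to `S`, and STOPS the
moment an open edge leads to a vertex of the target set `T` (Gladkov arXiv:2408.08457 §6.2: the
DFS from `a` stopped at `b` or `c`).  The state is the current vertex `top`, the stack `L` of
`(edge, vertex below)` pairs down to the start vertex — the backtracking path — and the set `Q`
of fully explored (popped) vertices; `U` is the set of unqueried edges.  `dfsStop` computes the
stop result of the same run (`some u` for a stop at the target `u`, `none` for an exhausted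
cluster) and `stopEvent` is the event «the DFS stops at `u`».

What a leaf knows (`LeafState`): either the tree stopped through an open edge `e` from `top` to
`u ∈ T`, with the stack an open path `PathOK` from `top` down to `a`, every popped vertex fully
queried, every queried open edge (other than `e`) inside the explored vertex set, and no target
explored; or the cluster of `a` was exhausted inside the popped set `Q`, whose boundary is queried
and closed.  `DFSGood.lean` proves this for every configuration in every leaf's cylinder together
with `DTree.Decides` for the event «`a` reaches `T`» (`reachEvent`), by one induction following
the recursion; here: the definitions, the stack-path lemmas, and that the tree is proper and
sends every edge to `S` (`allS_dfs`, `proper_dfs`).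

Part A of `DFSTree` (split for the ≤ 400-line lint; proofs byte-identical) — the last part `DFSTree.lean` imports it.
-/

namespace PercRepro

namespace MultiGraph

variable {V E : Type*} {G : MultiGraph V E}

/-! ### Explored vertices and open paths along the stack -/

/-- The explored vertices: the current vertex, the stack, and the popped vertices. -/
def explored (top : V) (L : List (E × V)) (Q : Finset V) : Set V :=
  {x | x = top ∨ x ∈ L.map Prod.snd ∨ x ∈ Q}

/-- Membership in `explored`. -/
theorem mem_explored {top : V} {L : List (E × V)} {Q : Finset V} {x : V} :
    x ∈ explored top L Q ↔ x = top ∨ x ∈ L.map Prod.snd ∨ x ∈ Q := Iff.rfl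

/-- `PathOK ω L top a`: the stack `L` of `(edge, vertex below)` pairs is a path of `ω`-open
edges from `top` down to `a`. -/
def PathOK (ω : Config E) : List (E × V) → V → V → Prop
  | [], top, a => top = a
  | (e, w) :: L, top, a =>
      ω e = true ∧ ((G.fst e = top ∧ G.snd e = w) ∨ (G.fst e = w ∧ G.snd e = top)) ∧
        PathOK ω L w a

/-- Every edge of the stack is open. -/
theorem PathOK.open_of_mem {ω : Config E} : ∀ {L : List (E × V)} {top a : V},
    G.PathOK ω L top a → ∀ x ∈ L, ω x.1 = true := by
  intro L
  induction L with
  | nil => intro _ _ _ x hx; simp at hx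
  | cons y L ih =>
    intro top a h x hx
    obtain ⟨e, w⟩ := y
    obtain ⟨he, -, hL⟩ := h
    rcases List.mem_cons.mp hx with rfl | hx
    · exact he
    · exact ih hL x hx

/-- The path only looks at its own edges. -/
theorem PathOK.congr {ω ζ : Config E} : ∀ {L : List (E × V)} {top a : V},
    G.PathOK ω L top a → (∀ x ∈ L, ζ x.1 = ω x.1) → G.PathOK ζ L top a := by
  intro L
  induction L with
  | nil => intro _ _ h _; exact h
  | cons y L ih =>
    intro top a h hζ
    obtain ⟨e, w⟩ := y
    obtain ⟨he, hend, hL⟩ := h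
    refine ⟨(hζ (e, w) (by simp)).trans he, hend, ih hL fun x hx => hζ x (by simp [hx])⟩

/-- The top of an open path is connected to its bottom. -/
theorem PathOK.conn {ω : Config E} : ∀ {L : List (E × V)} {top a : V},
    G.PathOK ω L top a → G.Conn ω top a := by
  intro L
  induction L with
  | nil => intro top a h; rw [h]; exact Conn.refl G ω a
  | cons y L ih =>
    intro top a h
    obtain ⟨e, w⟩ := y
    obtain ⟨he, hend, hL⟩ := h
    refine Conn.trans (Conn.of_openAdj ⟨e, he, ?_⟩) (ih hL)
    rcases hend with ⟨h1, h2⟩ | ⟨h1, h2⟩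
    · exact Or.inl ⟨h1, h2⟩
    · exact Or.inr ⟨h1, h2⟩

/-- The vertices of the stack are connected to the top. -/
theorem PathOK.conn_of_mem {ω : Config E} : ∀ {L : List (E × V)} {top a : V},
    G.PathOK ω L top a → ∀ x ∈ L.map Prod.snd, G.Conn ω top x := by
  intro L
  induction L with
  | nil => intro _ _ _ x hx; simp at hx
  | cons y L ih =>
    intro top a h x hx
    obtain ⟨e, w⟩ := y
    obtain ⟨he, hend, hL⟩ := h
    have hstep : G.Conn ω top w := by
      refine Conn.of_openAdj ⟨e, he, ?_⟩
      rcases hend with ⟨h1, h2⟩ | ⟨h1, h2⟩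
      · exact Or.inl ⟨h1, h2⟩
      · exact Or.inr ⟨h1, h2⟩
    rcases List.mem_cons.mp hx with rfl | hx
    · exact hstep
    · exact Conn.trans hstep (ih hL x hx)

/-- The bottom of the stack is a stack vertex. -/
theorem PathOK.bottom_mem {ω : Config E} : ∀ {L : List (E × V)} {top a : V},
    G.PathOK ω L top a → a ∈ top :: L.map Prod.snd := by
  intro L
  induction L with
  | nil => intro top a h; rw [h]; exact List.mem_singleton_self a
  | cons y L ih =>
    intro top a h
    obtain ⟨e, w⟩ := y
    exact List.mem_cons_of_mem _ (ih h.2.2)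

/-- **Splitting the stack**: the vertex at depth `m` from the top is joined to the top by the
first `m` edges and to the bottom by the remaining edges (each as a witness-style statement: any
configuration agreeing with `ω` on those edges has the connection). -/
theorem PathOK.split {ω : Config E} : ∀ {L : List (E × V)} {top a : V},
    G.PathOK ω L top a → ∀ m (hm : m < (top :: L.map Prod.snd).length),
      (∀ ζ : Config E, (∀ x ∈ L.take m, ζ x.1 = ω x.1) →
          G.Conn ζ top ((top :: L.map Prod.snd)[m])) ∧
      (∀ ζ : Config E, (∀ x ∈ L.drop m, ζ x.1 = ω x.1) →
          G.Conn ζ ((top :: L.map Prod.snd)[m]) a) := by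
  intro L
  induction L with
  | nil =>
    intro top a h m hm
    simp only [List.map_nil, List.length_singleton, Nat.lt_one_iff] at hm
    subst hm
    simp only [List.getElem_cons_zero, List.take_nil, List.drop_nil]
    exact ⟨fun ζ _ => Conn.refl G ζ top, fun ζ _ => by rw [h]; exact Conn.refl G ζ a⟩
  | cons y L ih =>
    intro top a h m hm
    obtain ⟨e, w⟩ := y
    have hcopy : G.PathOK ω ((e, w) :: L) top a := h
    obtain ⟨he, hend, hL⟩ := h
    cases m with
    | zero =>
      simp only [List.getElem_cons_zero, List.take_zero, List.drop_zero]
      refine ⟨fun ζ _ => Conn.refl G ζ top, fun ζ hζ => ?_⟩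
      exact (PathOK.congr hcopy hζ).conn
    | succ m =>
      simp only [List.map_cons, List.length_cons, Nat.succ_lt_succ_iff] at hm
      simp only [List.map_cons, List.getElem_cons_succ, List.take_succ_cons, List.drop_succ_cons]
      obtain ⟨h1, h2⟩ := ih hL m hm
      refine ⟨fun ζ hζ => ?_, fun ζ hζ => h2 ζ hζ⟩
      have hζe : ζ e = true := (hζ (e, w) (by simp)).trans he
      refine Conn.trans (Conn.of_openAdj ⟨e, hζe, ?_⟩) (h1 ζ fun x hx => hζ x (by simp [hx]))
      rcases hend with ⟨h1', h2'⟩ | ⟨h1', h2'⟩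
      · exact Or.inl ⟨h1', h2'⟩
      · exact Or.inr ⟨h1', h2'⟩

/-! ### The invariant and the leaf states -/

/-- The DFS invariant for a configuration `ω`: the stack is an open path down to `a` of
queried, distinct edges; popped vertices are fully queried; queried open edges lie inside the
explored set; no target is explored. -/
structure Inv (T : Finset V) (a : V) (U : Finset E) (top : V) (L : List (E × V)) (Q : Finset V)
    (ω : Config E) : Prop where
  path : G.PathOK ω L top a
  pathNotU : ∀ x ∈ L, x.1 ∉ U
  nodup : (L.map Prod.fst).Nodup
  explQ : ∀ q ∈ Q, ∀ e ∈ U, G.fst e ≠ q ∧ G.snd e ≠ q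
  openIn : ∀ e, e ∉ U → ω e = true → G.fst e ∈ explored top L Q ∧ G.snd e ∈ explored top L Q
  noT : ∀ t ∈ T, t ∉ explored top L Q

/-- The event «`a` is joined to some vertex of `T`». -/
def reachEvent (a : V) (T : Finset V) : Set (Config E) := {ω | ∃ t ∈ T, G.Conn ω a t}

/-- What a leaf of the DFS knows about `ω` in terms of the queried set `S` and the stop result
`r` (`some u` for a stop at the target `u`, `none` for an exhausted cluster): a stop through the
open edge `e` from `top` to `u ∈ T` on top of an open stack path down to `a`, or an exhausted
cluster inside the popped set `Q`. -/
def LeafState (T : Finset V) (a : V) (ω : Config E) (S : Set E) (r : Option V) : Prop :=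
  (∃ (top : V) (L : List (E × V)) (Q : Finset V) (e : E) (u : V),
    r = some u ∧ u ∈ T ∧ e ∈ S ∧ ω e = true ∧
      ((G.fst e = top ∧ G.snd e = u) ∨ (G.fst e = u ∧ G.snd e = top)) ∧
      e ∉ L.map Prod.fst ∧ G.PathOK ω L top a ∧ (∀ x ∈ L, x.1 ∈ S) ∧ (L.map Prod.fst).Nodup ∧
      (∀ q ∈ Q, ∀ e', (G.fst e' = q ∨ G.snd e' = q) → e' ∈ S) ∧
      (∀ e' ∈ S, e' ≠ e → ω e' = true →
        G.fst e' ∈ explored top L Q ∧ G.snd e' ∈ explored top L Q) ∧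
      (∀ t ∈ T, t ∉ explored top L Q)) ∨
  (r = none ∧ ∃ Q : Finset V, a ∈ Q ∧ (∀ q ∈ Q, ∀ e', (G.fst e' = q ∨ G.snd e' = q) → e' ∈ S) ∧
    (∀ e' ∈ S, ω e' = true → G.fst e' ∈ Q ∧ G.snd e' ∈ Q) ∧ (∀ t ∈ T, t ∉ Q))

end MultiGraph

end PercRepro
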